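import Literature.AnabelianGeometry.EtaleTheta.Discharge.Sec1TranslatesNonTorsion
import Literature.AnabelianGeometry.EtaleTheta.Discharge.Sec2DtpYThetaAbelian
import Literature.AnabelianGeometry.EtaleTheta.DoubleUnderline
import Mathlib.GroupTheory.OrderOfElement

/-!
# [EtTh] §2 over §1: every `l`-th power of `(Δ^tp_Ÿ)^Θ` lies in `(Δ^tp_Ÿ̲̲)^Θ`, and the `Z`-translates of a
# theta class restricted to `Π^tp_Ÿ̲̲` are non-torsion (the power condition `hpow` DISCHARGED)

Mochizuki, *The étale theta function …* [EtTh], Publ. RIMS **45** (2009), §2, Def. 2.7, PRIMS PDF p. 41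
("new coverings `Ÿ̲̲ → Ÿ`; `Y̲̲ → Y` of degree `l`", "`Π^tp_X̲̲/Π^tp_Ÿ̲̲ ≅ (l·ℤ) × μ₂`") and Prop. 2.2 (ii) p. 37
("`Δ_X̲ = Δ_X̲̲ · Δ_Θ`" — the geometric index `l` of `X̲̲ → X̲` sits in the `Δ_Θ`-direction)
[cite: MochizukiEtTh2009, Def 2.7 p.41]. PROOF-ONLY companion (0 definitions) of `DoubleUnderline.lean`
(cell abc-iut, layer L2, seat abc-iut-L2-t8 — owner of the `X̲̲` adapter `ThetaCyclotomes` / `DoubleUnderline` /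
`ThetaEnvOfSetting` / `RigidOfSetting`).

WHAT IS PROVED. For the §1 root `D : ThetaSetting p`, étale theta data `E` and a choice `C : E.DoubleUnderline l`
of the covering `X̲̲` (`Π^tp_X̲̲ = C.Huu`, `Π^tp_Ÿ̲̲ = C.GtpYdduu = Π^tp_Ÿ ∩ Π^tp_X̲̲`):

* `relIndex_inf_GtpY_dtpYddN_one_dvd` — `[Δ^tp_Ÿ : Δ^tp_Ÿ ∩ Π^tp_X̲̲]` DIVIDES `l`: since `Δ^tp_Ÿ = Π^tp_Ÿ ∩ Δ^tp_X`
  is normal in `Π^tp_X` (`Compat.GtpYdd_normal`), `[Δ^tp_Ÿ : Δ^tp_Ÿ ∩ Π^tp_Y̲̲] = [Π^tp_Y̲̲ · Δ^tp_Ÿ : Π^tp_Y̲̲]`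
  (second isomorphism theorem, `ClassTwo.relIndex_sup_eq_relIndex`), which divides
  `[Π^tp_Y : Π^tp_Y̲̲] = l` (the field `relIndex_Huu_GtpY`, "`Y̲̲ → Y` of degree `l`");
* **`pow_mem_map_toTheta_GtpYdduu`** (`hpow_GtpYdduu`, `hpow_of_GtpYdduu_le`) — EVERY `l`-TH POWER OF `(Δ^tp_Ÿ)^Θ`
  LIES IN `(Δ^tp_Ÿ̲̲)^Θ :=` the image of `Π^tp_Ÿ̲̲ ∩ Δ^tp_X` in `(Π^tp_X)^Θ`: the index of the image divides the index
  `∣ l` above (`relIndex_map_toTheta_GtpYdduu_dvd`), and `(Δ^tp_Ÿ)^Θ ⊆ (Δ^tp_Y)^Θ` is ABELIAN (`dtpYTheta_comm`,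
  [EtTh] p. 12, proved from the freeness guard `IsEtThOrigin`), so `Subgroup.pow_index_mem` applies in the
  commutative group `(Δ^tp_Ÿ)^Θ` (generic `pow_mem_of_relIndex_dvd_of_comm`). This is the power condition `hpow`
  (with `H' := Π^tp_Ÿ̲̲`, `m := l`) of abc-iut-L2-t1's `not_isOfFinOrder_res_conj_zpow_div` /
  `not_isOfFinOrder_comap_conj_zpow_div` (`Sec1TranslatesNonTorsion.lean`);
* **`not_isOfFinOrder_res_conj_zpow_div_GtpYdduu`**, **`not_isOfFinOrder_comap_conj_zpow_div_of_GtpYdduu_le`** —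
  those theorems SPECIALISED to `Π^tp_Ÿ̲̲` with `hpow` discharged: for a theta class `x ∈ O^×_K̈ · η̈^Θ`,
  `γ ∈ Π^tp_X` with non-trivial image in `Z` and `k ≠ 0`, the restriction to `Π^tp_Ÿ̲̲` (resp. the pull-back to
  any `H₀` with `Π^tp_Ÿ̲̲ ⊆ ι(H₀) ⊆ Π^tp_Ÿ`) of `(γᵏ · x) · x⁻¹` is NOT a torsion class — modulo exactly the
  named §1 facts `Prop15iii`, `Prop15ii` (FACT policy), the printed untyped clause `hL` of Prop. 1.5 (ii)
  ("`F̈¹/F̈² = Ẑ · log(Ü)`", plan/GAP-LEDGER G-L2t1-1) and `IsEtThOrigin`;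
* `toZ_coe_ne_one_of_toLZ_ne_one`, `toZ_coe_ne_one_of_toLZ_eq_ofAdd_one` — a generator `γ` of
  `Π^tp_X̲̲ ↠ Gal(Y̲̲/X̲̲) ≅ ℤ` (`C.toLZ γ = 1 ∈ ℤ`) has non-trivial image in `Z`.

Consumer: binder `hfree` (R3) of `Literature.IUT.HodgeArakelov.prop22_ii'_model` ([IUTchII] Prop. 2.2 (ii) at the
model; plan/GAP-LEDGER G-w4d010-2) via abc-iut-L2-t8's `EtaleThetaDataOfSetting.hfree_of_etaDd_free`.
HYPOTHESIS HYGIENE: no new `def … : Prop`; binders `hC : D.Compat` (a theorem, `Sec1CompatHolds`),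
`hO : D.IsEtThOrigin` (freeness guard of `Setting.lean`), `h15`/`h15ii`/`hL` as in `Sec1TranslatesNonTorsion.lean`.
HONEST FRAMING: [EtTh] is refereed and undisputed; typed ≠ proved; nothing here bears on [IUTchIII] Cor. 3.12.
-/

noncomputable section

namespace Literature.AnabelianGeometry.EtaleTheta

open Literature.AnabelianGeometry.SemiGraphs

namespace ThetaSetting

variable {p : ℕ} [Fact p.Prime] {D : ThetaSetting p}

/-! ## `Δ^tp_Ÿ` inside `Π^tp_Y` -/

/-- `Δ^tp_Ÿ = Π^tp_Ÿ ∩ Δ^tp_X ≤ Π^tp_Y` (`Ÿ → Y`, p. 17). [cite: MochizukiEtTh2009, §1 p.17] -/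
theorem dtpYddN_one_le_GtpY : D.DtpYddN 1 ≤ D.GtpY :=
  (inf_le_left : D.GtpYddN 1 ⊓ D.DeltaTemp ≤ D.GtpYddN 1).trans D.GtpYdd_le_GtpY

/-- `Δ^tp_Ÿ ≤ Δ^tp_Y`, hence `(Δ^tp_Ÿ)^Θ ≤ (Δ^tp_Y)^Θ` (images in the theta quotient, p. 12).
[cite: MochizukiEtTh2009, §1 p.12] -/
theorem map_toTheta_dtpYddN_one_le_DtpYTheta : (D.DtpYddN 1).map D.toTheta ≤ D.DtpYTheta :=
  Subgroup.map_mono (inf_le_inf_right D.DeltaTemp D.GtpYdd_le_GtpY : D.GtpYddN 1 ⊓ D.DeltaTemp ≤ _)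

/-- `Δ^tp_Ÿ` is normal in `Π^tp_X` (`Π^tp_Ÿ ⊴ Π^tp_X`, abc-iut-L2-t1's `Compat.GtpYdd_normal`; `Δ^tp_X = Ker`
of the augmentation). [cite: MochizukiEtTh2009, §1 p.17] -/
theorem dtpYddN_one_normal (hC : D.Compat) : (D.DtpYddN 1).Normal := by
  haveI := hC.GtpYdd_normal
  haveI : D.DeltaTemp.Normal := inferInstanceAs D.aug.toMonoidHom.ker.Normal
  change (D.GtpYdd ⊓ D.DeltaTemp).Normal
  infer_instance

/-- `(Δ^tp_Ÿ)^Θ` is commutative: it lies in the abelian `(Δ^tp_Y)^Θ` ([EtTh] p. 12, abc-iut-L2-t8's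
`dtpYTheta_comm` from the freeness guard `IsEtThOrigin`). [cite: MochizukiEtTh2009, §1 p.12] -/
theorem map_toTheta_dtpYddN_one_comm (hO : D.IsEtThOrigin) :
    ∀ x ∈ (D.DtpYddN 1).map D.toTheta, ∀ y ∈ (D.DtpYddN 1).map D.toTheta, x * y = y * x :=
  fun x hx y hy => D.dtpYTheta_comm hO x (map_toTheta_dtpYddN_one_le_DtpYTheta hx) y
    (map_toTheta_dtpYddN_one_le_DtpYTheta hy)

namespace EtaleThetaData.DoubleUnderline

variable {E : D.EtaleThetaData} {l : ℕ} (C : E.DoubleUnderline l)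

/-! ## The degree bookkeeping of `Ÿ̲̲ → Ÿ` on the geometric side -/

/-- `Π^tp_Y̲̲ ∩ Δ^tp_Ÿ = Π^tp_Ÿ̲̲ ∩ Δ^tp_X` (`Π^tp_Y̲̲ = Π^tp_X̲̲ ∩ Π^tp_Y`, `Π^tp_Ÿ̲̲ = Π^tp_Ÿ ∩ Π^tp_X̲̲`, `Π^tp_Ÿ ≤ Π^tp_Y`;
p. 41). [cite: MochizukiEtTh2009, Def 2.7 p.41] -/
theorem inf_GtpY_inf_dtpYddN_one : C.Huu ⊓ D.GtpY ⊓ D.DtpYddN 1 = C.GtpYdduu ⊓ D.DeltaTemp := by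
  ext x
  simp only [Subgroup.mem_inf]
  constructor
  · rintro ⟨⟨hxH, -⟩, hxYdd, hxΔ⟩
    exact ⟨⟨hxYdd, hxH⟩, hxΔ⟩
  · rintro ⟨⟨hxYdd, hxH⟩, hxΔ⟩
    exact ⟨⟨hxH, D.GtpYdd_le_GtpY hxYdd⟩, hxYdd, hxΔ⟩

/-- **`[Δ^tp_Ÿ : Δ^tp_Ÿ ∩ Π^tp_X̲̲]` divides `l`**: `Δ^tp_Ÿ ⊴ Π^tp_X`, so
`[Δ^tp_Ÿ : Δ^tp_Ÿ ∩ Π^tp_Y̲̲] = [Π^tp_Y̲̲ · Δ^tp_Ÿ : Π^tp_Y̲̲]` divides `[Π^tp_Y : Π^tp_Y̲̲] = l` ("`Y̲̲ → Y` of degree `l`",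
p. 41; field `relIndex_Huu_GtpY`). [cite: MochizukiEtTh2009, Def 2.7 p.41] -/
theorem relIndex_inf_GtpY_dtpYddN_one_dvd (hC : D.Compat) :
    (C.Huu ⊓ D.GtpY).relIndex (D.DtpYddN 1) ∣ l := by
  haveI := dtpYddN_one_normal (D := D) hC
  have hsup : C.Huu ⊓ D.GtpY ⊔ D.DtpYddN 1 ≤ D.GtpY := sup_le inf_le_right dtpYddN_one_le_GtpY
  have h1 : (C.Huu ⊓ D.GtpY).relIndex (C.Huu ⊓ D.GtpY ⊔ D.DtpYddN 1) =
      (C.Huu ⊓ D.GtpY).relIndex (D.DtpYddN 1) :=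
    ClassTwo.relIndex_sup_eq_relIndex (C.Huu ⊓ D.GtpY) (D.DtpYddN 1)
  have h2 := Subgroup.relIndex_mul_relIndex (C.Huu ⊓ D.GtpY) (C.Huu ⊓ D.GtpY ⊔ D.DtpYddN 1) D.GtpY
    le_sup_left hsup
  rw [h1, C.relIndex_Huu_GtpY] at h2
  exact Dvd.intro _ h2

/-- **`[(Δ^tp_Ÿ)^Θ : (Δ^tp_Ÿ̲̲)^Θ]` divides `l`**, where `(Δ^tp_Ÿ̲̲)^Θ :=` the image of `Π^tp_Ÿ̲̲ ∩ Δ^tp_X` in `(Π^tp_X)^Θ`: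
an index can only drop under a homomorphism (`Subgroup.relIndex_comap`, `Subgroup.relIndex_dvd_of_le_left`), and
`[Δ^tp_Ÿ : Δ^tp_Ÿ ∩ Π^tp_X̲̲] ∣ l` (`relIndex_inf_GtpY_dtpYddN_one_dvd`). [cite: MochizukiEtTh2009, Def 2.7 p.41] -/
theorem relIndex_map_toTheta_GtpYdduu_dvd (hC : D.Compat) :
    ((C.GtpYdduu ⊓ D.DeltaTemp).map D.toTheta).relIndex ((D.DtpYddN 1).map D.toTheta) ∣ l := by
  have h1 : (((C.GtpYdduu ⊓ D.DeltaTemp).map D.toTheta).comap D.toTheta).relIndex (D.DtpYddN 1) =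
      ((C.GtpYdduu ⊓ D.DeltaTemp).map D.toTheta).relIndex ((D.DtpYddN 1).map D.toTheta) :=
    ((C.GtpYdduu ⊓ D.DeltaTemp).map D.toTheta).relIndex_comap D.toTheta (D.DtpYddN 1)
  have hle : C.Huu ⊓ D.GtpY ⊓ D.DtpYddN 1 ≤ ((C.GtpYdduu ⊓ D.DeltaTemp).map D.toTheta).comap D.toTheta := by
    rw [C.inf_GtpY_inf_dtpYddN_one]
    exact Subgroup.le_comap_map D.toTheta (C.GtpYdduu ⊓ D.DeltaTemp)
  have h2 : (((C.GtpYdduu ⊓ D.DeltaTemp).map D.toTheta).comap D.toTheta).relIndex (D.DtpYddN 1) ∣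
      (C.Huu ⊓ D.GtpY ⊓ D.DtpYddN 1).relIndex (D.DtpYddN 1) :=
    Subgroup.relIndex_dvd_of_le_left (D.DtpYddN 1) hle
  have h3 : (C.Huu ⊓ D.GtpY ⊓ D.DtpYddN 1).relIndex (D.DtpYddN 1) =
      (C.Huu ⊓ D.GtpY).relIndex (D.DtpYddN 1) :=
    Subgroup.inf_relIndex_right (C.Huu ⊓ D.GtpY) (D.DtpYddN 1)
  rw [h1, h3] at h2
  exact h2.trans (C.relIndex_inf_GtpY_dtpYddN_one_dvd hC)

/-- Generic: in a group, if the subgroup `A` is COMMUTATIVE and `[A : S ∩ A]` divides `m`, then `g ^ m ∈ S` for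
every `g ∈ A` (`S ∩ A` is normal in the commutative `A`; `Subgroup.pow_index_mem`). Used for `A := (Δ^tp_Ÿ)^Θ`,
`S := (Δ^tp_Ÿ̲̲)^Θ`, `m := l`. [cite: MochizukiEtTh2009, Def 2.7 p.41] -/
theorem pow_mem_of_relIndex_dvd_of_comm {G : Type*} [Group G] {S A : Subgroup G}
    (hcomm : ∀ x ∈ A, ∀ y ∈ A, x * y = y * x) {m : ℕ} (hdvd : S.relIndex A ∣ m) {g : G} (hg : g ∈ A) :
    g ^ m ∈ S := by
  haveI : (S.subgroupOf A).Normal := ⟨fun n hn a => by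
    rw [Subgroup.mem_subgroupOf] at hn ⊢
    have h : ((a * n * a⁻¹ : A) : G) = (n : G) := by
      rw [Subgroup.coe_mul, Subgroup.coe_mul, Subgroup.coe_inv, hcomm _ a.2 _ n.2, mul_inv_cancel_right]
    rw [h]
    exact hn⟩
  have hmem : ((⟨g, hg⟩ : A) ^ (S.subgroupOf A).index) ∈ S.subgroupOf A :=
    Subgroup.pow_index_mem (S.subgroupOf A) ⟨g, hg⟩
  rw [Subgroup.mem_subgroupOf, SubgroupClass.coe_pow] at hmem
  obtain ⟨c, hc⟩ := hdvd
  rw [hc, pow_mul]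
  exact S.pow_mem hmem c

/-- **Every `l`-th power of `(Δ^tp_Ÿ)^Θ` lies in `(Δ^tp_Ÿ̲̲)^Θ`** (the image of `Π^tp_Ÿ̲̲ ∩ Δ^tp_X` in `(Π^tp_X)^Θ`):
the index of `(Δ^tp_Ÿ̲̲)^Θ` in `(Δ^tp_Ÿ)^Θ` divides `[Δ^tp_Ÿ : Δ^tp_Ÿ ∩ Π^tp_X̲̲] ∣ l`, and `(Δ^tp_Ÿ)^Θ ⊆ (Δ^tp_Y)^Θ` is
abelian (p. 12). This is the power condition `hpow` of abc-iut-L2-t1's `not_isOfFinOrder_res_conj_zpow_div` for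
`H' := Π^tp_Ÿ̲̲`, `m := l` ("`Π^tp_X̲̲/Π^tp_Ÿ̲̲ ≅ (l·ℤ) × μ₂`", "`Δ_X̲ = Δ_X̲̲ · Δ_Θ`": the degree `l` of `Ÿ̲̲ → Ÿ` is geometric
and sits in the `Δ_Θ`-direction). [cite: MochizukiEtTh2009, Def 2.7 p.41] -/
theorem pow_mem_map_toTheta_GtpYdduu (hC : D.Compat) (hO : D.IsEtThOrigin)
    {g : D.GtpTheta} (hg : g ∈ (D.DtpYddN 1).map D.toTheta) :
    g ^ l ∈ (C.GtpYdduu ⊓ D.DeltaTemp).map D.toTheta :=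
  pow_mem_of_relIndex_dvd_of_comm (map_toTheta_dtpYddN_one_comm (D := D) hO)
    (C.relIndex_map_toTheta_GtpYdduu_dvd hC) hg

/-- The same as a `∀`-clause, in the exact shape of the hypothesis `hpow` of
`not_isOfFinOrder_res_conj_zpow_div` with `H' := Π^tp_Ÿ̲̲ = C.GtpYdduu`, `m := l`.
[cite: MochizukiEtTh2009, Def 2.7 p.41] -/
theorem hpow_GtpYdduu (hC : D.Compat) (hO : D.IsEtThOrigin) :
    ∀ g ∈ (D.DtpYddN 1).map D.toTheta, g ^ l ∈ (C.GtpYdduu ⊓ D.DeltaTemp).map D.toTheta :=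
  fun _ hg => C.pow_mem_map_toTheta_GtpYdduu hC hO hg

/-- The power condition for any intermediate `Π^tp_Ÿ̲̲ ⊆ H' (⊆ Π^tp_Ÿ)`: every `l`-th power of `(Δ^tp_Ÿ)^Θ` lies in
`(H' ∩ Δ^tp_X)^Θ`. [cite: MochizukiEtTh2009, Def 2.7 p.41] -/
theorem hpow_of_GtpYdduu_le (hC : D.Compat) (hO : D.IsEtThOrigin) {H' : Subgroup D.PiTemp}
    (hle : C.GtpYdduu ≤ H') :
    ∀ g ∈ (D.DtpYddN 1).map D.toTheta, g ^ l ∈ (H' ⊓ D.DeltaTemp).map D.toTheta :=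
  fun _ hg => Subgroup.map_mono (inf_le_inf_right D.DeltaTemp hle) (C.pow_mem_map_toTheta_GtpYdduu hC hO hg)

/-! ## Generators of `Gal(Y̲̲/X̲̲) ≅ ℤ` have non-trivial image in `Z` -/

/-- An element of `Π^tp_X̲̲` with non-trivial image in `Gal(Y̲̲/X̲̲) ≅ ℤ` (`toLZ = toZ/l`) has non-trivial image in
`Z = Gal(Y/X)` (`toZ = l · toLZ`, Def. 2.13 (i) p. 47). [cite: MochizukiEtTh2009, Def 2.13 (i) p.47] -/
theorem toZ_coe_ne_one_of_toLZ_ne_one {γ : C.Huu} (hγ : C.toLZ γ ≠ 1) : D.toZ (γ : D.PiTemp) ≠ 1 := by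
  intro h1
  apply hγ
  have hmem : γ ∈ C.toLZ.ker := by
    rw [C.toLZ_ker, Subgroup.mem_subgroupOf]
    exact h1
  exact hmem

/-- In particular for a GENERATOR `γ` of `Π^tp_X̲̲ ↠ Gal(Y̲̲/X̲̲) ≅ ℤ` (`C.toLZ γ = 1 ∈ ℤ`, the binder `hγ` of
`Literature.IUT.HodgeArakelov.prop22_ii'_model`): `toZ γ ≠ 1`, i.e. `γ ↦ a = l ≠ 0` in `Z`.
[cite: MochizukiEtTh2009, Def 2.13 (i) p.47] -/
theorem toZ_coe_ne_one_of_toLZ_eq_ofAdd_one {γ : C.Huu} (hγ : C.toLZ γ = Multiplicative.ofAdd 1) :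
    D.toZ (γ : D.PiTemp) ≠ 1 :=
  C.toZ_coe_ne_one_of_toLZ_ne_one (by rw [hγ]; decide)

/-! ## The `Z`-translates of a theta class restricted to `Π^tp_Ÿ̲̲` are non-torsion -/

/-- **Non-torsion on `Π^tp_Ÿ̲̲`** ([EtTh] Prop. 1.4 (i)/(iii) + Prop. 1.5 (ii)/(iii) at the class level, restricted to
the covering `Ÿ̲̲ → Ÿ` of §2): for a theta class `x ∈ O^×_K̈ · η̈^Θ`, `γ ∈ Π^tp_X` with `γ ↦ a ≠ 0` in `Z` and `k ≠ 0`, the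
restriction to `Π^tp_Ÿ̲̲ = Π^tp_Ÿ ∩ Π^tp_X̲̲` of `(γᵏ · x) · x⁻¹` is NOT a torsion class — abc-iut-L2-t1's
`not_isOfFinOrder_res_conj_zpow_div` with its power condition `hpow` DISCHARGED (`hpow_GtpYdduu`), modulo the
named facts `Prop15iii`, `Prop15ii`, the clause `hL` ("`F̈¹/F̈² = Ẑ · log(Ü)`") and `IsEtThOrigin`.
[cite: MochizukiEtTh2009, Prop 1.5 (iii) p.23] -/
theorem not_isOfFinOrder_res_conj_zpow_div_GtpYdduu (hC : D.Compat) (hO : D.IsEtThOrigin)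
    (h15 : Prop15iii E hC) (h15ii : Prop15ii E.toKummerData hC)
    (hL : ∀ n : ℤ, E.logUdd ^ n ∈ (Fdd2 : Subgroup (D.H1Theta (D.GtpYdd.map D.toTheta))) → n = 0)
    {γ : D.PiTemp} (hγ : D.toZ γ ≠ 1) {k : ℤ} (hk : k ≠ 0) {x : D.H1 D.GtpYdd}
    (hx : x ∈ E.thetaClasses) :
    haveI := hC.GtpYdd_normal
    ¬ IsOfFinOrder (ContH1.res D.toTheta D.DeltaTheta (inf_le_left : C.GtpYdduu ≤ D.GtpYdd)
      (ContH1.conj D.toTheta D.DeltaTheta (γ ^ k) x * x⁻¹)) :=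
  E.not_isOfFinOrder_res_conj_zpow_div hC h15 h15ii hL inf_le_left C.l_ne_zero (C.hpow_GtpYdduu hC hO)
    hγ hk hx

/-- **Pulled-back form** (the shape consumed by the [IUTchII] model, where `Π^tp_Ÿ̲̲ = Π_Ÿ(Π) ⊆ Π^tp_X̲̲ ↪ Π^tp_X` and
classes are pulled back along a continuous `ι` with `Π^tp_Ÿ̲̲ ⊆ ι(H₀) ⊆ Π^tp_Ÿ`): the pull-back to `H₀` of
`(γᵏ · x) · x⁻¹` is NOT a torsion class, under the same named inputs — abc-iut-L2-t1's
`not_isOfFinOrder_comap_conj_zpow_div` with `hpow` DISCHARGED. [cite: MochizukiEtTh2009, Prop 1.5 (iii) p.23] -/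
theorem not_isOfFinOrder_comap_conj_zpow_div_of_GtpYdduu_le (hC : D.Compat) (hO : D.IsEtThOrigin)
    (h15 : Prop15iii E hC) (h15ii : Prop15ii E.toKummerData hC)
    (hL : ∀ n : ℤ, E.logUdd ^ n ∈ (Fdd2 : Subgroup (D.H1Theta (D.GtpYdd.map D.toTheta))) → n = 0)
    {G₀ : Type*} [Group G₀] [TopologicalSpace G₀] {ι : G₀ →* D.PiTemp} (hι : Continuous ι)
    {H₀ : Subgroup G₀} (hH₀ : H₀.map ι ≤ D.GtpYdd) (hle : C.GtpYdduu ≤ H₀.map ι)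
    {γ : D.PiTemp} (hγ : D.toZ γ ≠ 1) {k : ℤ} (hk : k ≠ 0) {x : D.H1 D.GtpYdd}
    (hx : x ∈ E.thetaClasses) :
    haveI := hC.GtpYdd_normal
    ¬ IsOfFinOrder (ContH1.comap D.toTheta D.DeltaTheta ι hι hH₀
      (ContH1.conj D.toTheta D.DeltaTheta (γ ^ k) x * x⁻¹)) :=
  E.not_isOfFinOrder_comap_conj_zpow_div hC h15 h15ii hL hι hH₀ C.l_ne_zero (C.hpow_of_GtpYdduu_le hC hO hle)
    hγ hk hx

/-- The same for the étale theta class `x := η̈^Θ` itself and a generator `γ ∈ Π^tp_X̲̲` of `Gal(Y̲̲/X̲̲) ≅ ℤ` — the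
hypothesis `h14` of abc-iut-L2-t8's `EtaleThetaDataOfSetting.hfree_of_etaDd_free` up to the identification
`ι(H₀) ⊇ Π^tp_Ÿ̲̲`. [cite: MochizukiEtTh2009, Prop 1.5 (iii) p.23] -/
theorem not_isOfFinOrder_comap_conj_zpow_etaDd_div (hC : D.Compat) (hO : D.IsEtThOrigin)
    (h15 : Prop15iii E hC) (h15ii : Prop15ii E.toKummerData hC)
    (hL : ∀ n : ℤ, E.logUdd ^ n ∈ (Fdd2 : Subgroup (D.H1Theta (D.GtpYdd.map D.toTheta))) → n = 0)
    {G₀ : Type*} [Group G₀] [TopologicalSpace G₀] {ι : G₀ →* D.PiTemp} (hι : Continuous ι)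
    {H₀ : Subgroup G₀} (hH₀ : H₀.map ι ≤ D.GtpYdd) (hle : C.GtpYdduu ≤ H₀.map ι)
    {γ : C.Huu} (hγ : C.toLZ γ = Multiplicative.ofAdd 1) {k : ℤ} (hk : k ≠ 0) :
    haveI := hC.GtpYdd_normal
    ¬ IsOfFinOrder (ContH1.comap D.toTheta D.DeltaTheta ι hι hH₀
      (ContH1.conj D.toTheta D.DeltaTheta ((γ : D.PiTemp) ^ k) E.etaDd * E.etaDd⁻¹)) :=
  C.not_isOfFinOrder_comap_conj_zpow_div_of_GtpYdduu_le hC hO h15 h15ii hL hι hH₀ hle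
    (C.toZ_coe_ne_one_of_toLZ_eq_ofAdd_one hγ) hk E.etaDd_mem_thetaClasses

end EtaleThetaData.DoubleUnderline

end ThetaSetting

end Literature.AnabelianGeometry.EtaleTheta
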